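import Mathlib
import Literature.MathematicalPhysics.QuantumFieldTheory.Balaban1983to89.B5LaplaceSpectral

/-!
# B5 p. 22 (Sect. C): «the operator I − Δ⁻¹Q′*_k(Q′_kΔ⁻²Q′*_k)⁻¹Q′_kΔ⁻¹ is a projection» and «the
# quadratic form in ∂*A is defined by a projection operator» ((1.26)–(1.28)) — the abstract algebra

Source: T. Bałaban, *Propagators and renormalization transformations for lattice gauge
theories. I*, Commun. Math. Phys. 95 (1984) 17–40 (`Balaban1984PropagatorsI`, "B5"), render
`b2b-balaban-ref1/pages/1984-cmp95-propagators-rt-I/…-p006-x2.png` (PDF page 6 = journal page 22),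
read as an image.

## What the paper prints (verbatim, p. 22)

* «We assume that λ is orthogonal and we get λ = Δ⁻¹∂*A − Δ⁻²Q′*_kω. Substituting in the second
  equation we get Q′_kλ = Q′_kΔ⁻¹∂*A − Q′_kΔ⁻²Q′*_kω = 0. The operator Δ⁻² is positive on the
  subspace orthogonal to constant functions, hence Q′_kΔ⁻²Q′*_k is positive also on the corresponding
  subspace on the unit lattice. Because ω belongs to the subspace, so ω = (Q′_kΔ⁻²Q′*_k)⁻¹Q′_kΔ⁻¹∂*A
  and the infimum in (1.24) is acquired at the function
  λ₀ = Δ⁻¹∂*A − Δ⁻²Q′*_k(Q′_kΔ⁻²Q′*_k)⁻¹Q′_kΔ⁻¹∂*A.»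
* (1.26): «½‖∂*A − Δλ₀‖² = ½‖Δ⁻¹Q′*_k(Q′_kΔ⁻²Q′*_k)⁻¹Q′_kΔ⁻¹∂*A‖²
  = ½⟨∂*A, Δ⁻¹Q′*_k(Q′_kΔ⁻²Q′*_k)⁻¹Q′_kΔ⁻¹∂*A⟩, (1.26) where we have used the fact that the
  quadratic form in ∂*A is defined by a projection operator.»
* after (1.27): «It is easy to verify that the operator I − Δ⁻¹Q′*_k(Q′_kΔ⁻²Q′*_k)⁻¹Q′_kΔ⁻¹ is a
  projection in the space L²(T_η) of scalar functions, so we can write also» (1.28).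

## What is typed and certified here (kernel-checked, zero sorry)

ABSTRACT ALGEBRA over arbitrary finite index types `m`, `k`. INSTANTIATION (DOCFIX after cross-read
G-adv2-27): `m`, `k` index (bases of) the orthogonal COMPLEMENTS OF THE CONSTANTS in `L²(T_η)` resp.
in the unit-lattice `L²` — the reduced spaces on which B5 works (p. 22: «on the subspace orthogonal to
constant functions the operator Δ is positive», «Q′_kΔ⁻²Q′*_k is positive also on the corresponding
subspace on the unit lattice. Because ω belongs to the subspace»). They are NOT the full site sets:
with `L` = the printed `Δ⁻¹` extended by `0` on constants and `Q = Q′_k`, one has `L Qᴴ 𝟙 = 0`, so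
no `Minv` with `Minv·(Q L² Qᴴ) = 1` exists on the full unit-lattice space, and `Δ Δ⁻¹ = I` fails on
constants (`ΔΔ⁻¹ = I − P_const`, typed in `B5LaplaceInverse`, which also carries the full-torus
pseudo-inverse re-typing `residual_eq_pinv`/`residual_eq_torus` of `residual_eq` below). With that
reading: for a matrix `L` (playing `Δ⁻¹` restricted to the complement, Hermitian and invertible there),
a matrix `Q` (playing `Q′_k` between the complements, p. 22 «similarly for the orthogonal subspaces»)
and a matrix `Minv` with `Minv·(Q L² Qᴴ) = 1` (playing `(Q′_kΔ⁻²Q′*_k)⁻¹` on the unit-lattice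
complement; invertibility is the HYPOTHESIS — B5 derives it from positivity), with
`Pc := L Qᴴ Minv Q L` («Δ⁻¹Q′*(Q′Δ⁻²Q′*)⁻¹Q′Δ⁻¹»):
* `Pc_mul_Pc`, `one_sub_Pc_mul` — `Pc² = Pc`, `(I − Pc)² = I − Pc`: «is a projection»;
* `Minv_conjTranspose`, `Pc_conjTranspose` — for `L` Hermitian: `Minvᴴ = Minv`, `Pcᴴ = Pc`
  (orthogonal projections);
* `QL_mul_one_sub_Pc`, `constraint_lambda0` — `Q L (I − Pc) = 0`, i.e. `λ₀ := L(I − Pc)b` satisfies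
  «Q′_kλ₀ = 0» (the substitution step);
* `residual_eq` — `b − D λ₀ = Pc b` under the hypothesis `D * L = 1` (true on the complement of
  constants with `D = Δ`, `L = Δ⁻¹` restricted there; on the full torus use
  `B5LaplaceInverse.residual_eq_pinv`): the first equality of (1.26);
* `form_of_projection` — for `P² = P = Pᴴ`: `‖P x‖² = ⟨x, P x⟩`: «the quadratic form in ∂*A is
  defined by a projection operator» (second equality of (1.26), and (1.27) = (1.28)).

## What is NOT certified here

The instantiation `L = Δ⁻¹` (pseudo-inverse on the complement of constants), `Q = Q′_k`, the
positivity ⟹ invertibility of `Q′_kΔ⁻²Q′*_k`, the infimum claim (1.24) itself and the Gaussian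
integral identities (1.27)/(1.28); fiberwise versions are pass 5 (`Pproj`).
-/

open scoped BigOperators Matrix ComplexConjugate
open Finset Complex Matrix

namespace Literature.MathematicalPhysics.QuantumFieldTheory.Balaban1983to89.B5Projection127

noncomputable section

variable {m k : Type*} [Fintype m] [Fintype k] [DecidableEq m] [DecidableEq k]

/-- `Δ⁻¹Q′*_k(Q′_kΔ⁻²Q′*_k)⁻¹Q′_kΔ⁻¹` as abstract algebra: `Pc = L Qᴴ Minv Q L`.
[cite: Balaban1984PropagatorsI, (1.26) p.22] -/
def Pc (L : Matrix m m ℂ) (Q : Matrix k m ℂ) (Minv : Matrix k k ℂ) : Matrix m m ℂ :=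
  L * Qᴴ * Minv * Q * L

variable (L : Matrix m m ℂ) (Q : Matrix k m ℂ) (Minv : Matrix k k ℂ)

omit [DecidableEq m] in
/-- the cancellation `Minv (Q L² Qᴴ X) = X`. [folklore] -/
theorem Minv_cancel (hM : Minv * (Q * (L * L) * Qᴴ) = 1) (X : Matrix k m ℂ) :
    Minv * (Q * (L * (L * (Qᴴ * X)))) = X := by
  calc Minv * (Q * (L * (L * (Qᴴ * X)))) = Minv * (Q * (L * L) * Qᴴ) * X := by
        simp only [Matrix.mul_assoc]
    _ = X := by rw [hM, Matrix.one_mul]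

omit [DecidableEq m] in
/-- `Pc² = Pc`. [cite: Balaban1984PropagatorsI, Sect. C p.22] -/
theorem Pc_mul_Pc (hM : Minv * (Q * (L * L) * Qᴴ) = 1) :
    Pc L Q Minv * Pc L Q Minv = Pc L Q Minv := by
  simp only [Pc, Matrix.mul_assoc]
  rw [Minv_cancel L Q Minv hM]

/-- «It is easy to verify that the operator I − Δ⁻¹Q′*_k(Q′_kΔ⁻²Q′*_k)⁻¹Q′_kΔ⁻¹ is a projection»:
`(I − Pc)² = I − Pc`. [cite: Balaban1984PropagatorsI, Sect. C p.22] -/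
theorem one_sub_Pc_mul (hM : Minv * (Q * (L * L) * Qᴴ) = 1) :
    (1 - Pc L Q Minv) * (1 - Pc L Q Minv) = 1 - Pc L Q Minv := by
  rw [Matrix.sub_mul, Matrix.one_mul, Matrix.mul_sub, Matrix.mul_one, Pc_mul_Pc L Q Minv hM,
    sub_self, sub_zero]

omit [DecidableEq m] in
/-- for `L` Hermitian the inverse of the Hermitian `Q L² Qᴴ` is Hermitian. [folklore] -/
theorem Minv_conjTranspose (hL : Lᴴ = L) (hM : Minv * (Q * (L * L) * Qᴴ) = 1) :
    Minvᴴ = Minv := by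
  have hMH : (Q * (L * L) * Qᴴ)ᴴ = Q * (L * L) * Qᴴ := by
    rw [Matrix.conjTranspose_mul, Matrix.conjTranspose_mul, Matrix.conjTranspose_mul,
      Matrix.conjTranspose_conjTranspose, hL]
    simp only [Matrix.mul_assoc]
  have h1 : Q * (L * L) * Qᴴ * Minvᴴ = 1 := by
    have h := congrArg Matrix.conjTranspose hM
    rwa [Matrix.conjTranspose_mul, Matrix.conjTranspose_one, hMH] at h
  have h2 : Q * (L * L) * Qᴴ * Minv = 1 := mul_eq_one_comm.mp hM
  have h3 : Minvᴴ * (Q * (L * L) * Qᴴ) = 1 := mul_eq_one_comm.mp h1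
  calc Minvᴴ = Minvᴴ * (Q * (L * L) * Qᴴ * Minv) := by rw [h2, Matrix.mul_one]
    _ = Minvᴴ * (Q * (L * L) * Qᴴ) * Minv := by simp only [Matrix.mul_assoc]
    _ = Minv := by rw [h3, Matrix.one_mul]

omit [DecidableEq m] in
/-- `Pcᴴ = Pc`: an orthogonal projection. [cite: Balaban1984PropagatorsI, Sect. C p.22] -/
theorem Pc_conjTranspose (hL : Lᴴ = L) (hM : Minv * (Q * (L * L) * Qᴴ) = 1) :
    (Pc L Q Minv)ᴴ = Pc L Q Minv := by
  have hMi : Minvᴴ = Minv := Minv_conjTranspose L Q Minv hL hM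
  simp only [Pc, Matrix.conjTranspose_mul, Matrix.conjTranspose_conjTranspose, hL, hMi,
    Matrix.mul_assoc]

/-- `Q L (I − Pc) = 0`. [folklore] -/
theorem QL_mul_one_sub_Pc (hM : Minv * (Q * (L * L) * Qᴴ) = 1) :
    Q * L * (1 - Pc L Q Minv) = 0 := by
  have h2 : Q * (L * L) * Qᴴ * Minv = 1 := mul_eq_one_comm.mp hM
  rw [Matrix.mul_sub, Matrix.mul_one, sub_eq_zero]
  simp only [Pc]
  calc Q * L = (1 : Matrix k k ℂ) * (Q * L) := by rw [Matrix.one_mul]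
    _ = Q * (L * L) * Qᴴ * Minv * (Q * L) := by rw [h2]
    _ = Q * L * (L * Qᴴ * Minv * Q * L) := by simp only [Matrix.mul_assoc]

/-- the substitution step: `λ₀ := Δ⁻¹(I − Pc)∂*A` (= «Δ⁻¹∂*A − Δ⁻²Q′*(Q′Δ⁻²Q′*)⁻¹Q′Δ⁻¹∂*A»)
satisfies the constraint «Q′_kλ₀ = 0». [cite: Balaban1984PropagatorsI, Sect. C p.22] -/
theorem constraint_lambda0 (hM : Minv * (Q * (L * L) * Qᴴ) = 1) (b : m → ℂ) :
    Q *ᵥ (L *ᵥ ((1 - Pc L Q Minv) *ᵥ b)) = 0 := by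
  rw [Matrix.mulVec_mulVec, Matrix.mulVec_mulVec, QL_mul_one_sub_Pc L Q Minv hM,
    Matrix.zero_mulVec]

omit [DecidableEq k] in
/-- `λ₀` written out: `L(I − Pc)b = L b − L²Qᴴ Minv Q L b` («λ₀ = Δ⁻¹∂*A − Δ⁻²Q′*(…)⁻¹Q′Δ⁻¹∂*A»).
[cite: Balaban1984PropagatorsI, Sect. C p.22] -/
theorem lambda0_eq (b : m → ℂ) :
    L *ᵥ ((1 - Pc L Q Minv) *ᵥ b) = L *ᵥ b - (L * L * Qᴴ * Minv * Q * L) *ᵥ b := by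
  rw [Matrix.sub_mulVec, Matrix.one_mulVec, Matrix.mulVec_sub, Matrix.mulVec_mulVec]
  simp only [Pc, Matrix.mul_assoc]

omit [DecidableEq k] in
/-- first equality of (1.26): if `D L = I` (B5: `ΔΔ⁻¹ = I` on the complement of constants) then
`b − Dλ₀ = Pc b`. [cite: Balaban1984PropagatorsI, (1.26) p.22] -/
theorem residual_eq (D : Matrix m m ℂ) (hDL : D * L = 1) (b : m → ℂ) :
    b - D *ᵥ (L *ᵥ ((1 - Pc L Q Minv) *ᵥ b)) = Pc L Q Minv *ᵥ b := by
  rw [Matrix.mulVec_mulVec, hDL, Matrix.one_mulVec, Matrix.sub_mulVec, Matrix.one_mulVec,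
    sub_sub_cancel]

omit [DecidableEq m] in
/-- «the quadratic form in ∂*A is defined by a projection operator»: for `P² = P = Pᴴ`,
`‖P x‖² = ⟨x, P x⟩` (second equality of (1.26); (1.27) = (1.28)).
[cite: Balaban1984PropagatorsI, (1.26) p.22] -/
theorem form_of_projection (P : Matrix m m ℂ) (hP2 : P * P = P) (hPH : Pᴴ = P) (x : m → ℂ) :
    star (P *ᵥ x) ⬝ᵥ (P *ᵥ x) = star x ⬝ᵥ (P *ᵥ x) := by
  rw [Matrix.star_mulVec, hPH, ← dotProduct_mulVec, Matrix.mulVec_mulVec, hP2]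

omit [DecidableEq m] in
/-- hence for `Pc`: `‖Pc b‖² = ⟨b, Pc b⟩` ((1.26)). [cite: Balaban1984PropagatorsI, (1.26) p.22] -/
theorem form_Pc (hL : Lᴴ = L) (hM : Minv * (Q * (L * L) * Qᴴ) = 1) (b : m → ℂ) :
    star (Pc L Q Minv *ᵥ b) ⬝ᵥ (Pc L Q Minv *ᵥ b) = star b ⬝ᵥ (Pc L Q Minv *ᵥ b) :=
  form_of_projection _ (Pc_mul_Pc L Q Minv hM) (Pc_conjTranspose L Q Minv hL hM) b

end

end Literature.MathematicalPhysics.QuantumFieldTheory.Balaban1983to89.B5Projection127
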